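import Literature.Geometry.Lorentzian.KerrConvergence
import Literature.Geometry.Lorentzian.WeightedNorms
import HarnessLib

/-!
# Decorated tangent cone at timelike infinity: cone data and Kerr hole data

Hygiene definitions for the route `TangentConeAtIPlus` of the summit `FinalStateConjecture`
(`Summits/FinalStateConjecture/FinalStateConjecture/Theses/TangentConeAtIPlus.lean`, rev 0),
written over the sorry-free Lorentz prelude only (`KerrConvergence`: `ModelBackground`,
`Spacetime.IsLateChart`, `Spacetime.deviationCk/deviationExtend/truncDeviationCk`,
`Minkowski.backgroundOn`, `lorentzGroup`, `poincareInv`, `boostedKerrBackground`;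
`WeightedNorms`: `weightedCkSeminorm`; `KerrSchild`: `Kerr.IsSubextremal`; `Basic`:
`E4.spatialNorm`; `Causality`: `LorentzianMetric.causalFuture`).

The four cruxes of that route (`FiniteKerrParticleCone`, `KerrCaptureOnRays`,
`ConeCompletesScri`, `DecoratedConeExhausts`) share two `let`-inlined predicates, textually
identical in each item:

* `Cone 𝓢 S N mo σ dr T U Φ` — **cone data at `i⁺`** for a spacetime `𝓢` relative to a set
  `S ⊆ 𝓢.carrier` (in the route, `S = ι(Σ)` is the image of the Cauchy hypersurface):
  `N` straight world-lines `mo i = (Λᵢ, cᵢ) ∈ O(1,3) × E4` with near-zone radii `σᵢ → ∞` and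
  drifts `drᵢ` (both indexed by rest time) which are jointly sublinear,
  `(|σᵢ(s)| + ‖drᵢ(s)‖)/s → 0`; pairwise disjoint drifted fat tubes of width `5` after flat time
  `T`; a flat late chart `Φ : U → 𝓢.carrier` (`IsLateChart` for the Minkowski background on
  `U ⊇ {y⁰ > T} ∖ ⋃ᵢ tubeᵢ(0)` into `J⁺(S)`) with `Φ_* ∂₀` future-directed; scale-invariant
  weighted `C²`-flatness of `Φ^* g − η` in the timelike interior off the rays (the tangent cone
  at `i⁺` is flat with `N` inertial rays), plain `C²`-flatness on the whole slabs (wave zone);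
  and the BASIN clause: for each `i` one fixed sub-extremal `(Mᵢ, aᵢ)` such that for every
  `ε > 0`, at arbitrarily late rest times `τ`, some chart of the boosted Kerr exterior, glued to
  `Φ ∘ (x ↦ x + drᵢ(tᵢ x))` on the annulus `σᵢ + 1 ≤ dᵢ < σᵢ + 4`, is `ε`-close in `C²` to
  boosted Kerr on the truncated slab `{t*ᵢ = τ, rᵢ ≤ σᵢ(τ) + 5}`.
* `Holes 𝓢 S N mo σ dr T U Φ M a τ₀ Ψ` — **Kerr hole data** decorating the rays: sub-extremal
  parameters `(Mᵢ, aᵢ)`, a late rest time `τ₀ ≥ T` and smooth charts `Ψᵢ` of the boosted Kerr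
  exteriors, open embeddings of the near regions `Wᵢ = {tᵢ > τ₀, dᵢ < σᵢ(tᵢ) + |aᵢ| + 6}` into
  `J⁺(S)`, `C²`-converging to boosted Kerr on every truncated slab of fixed radius and out to
  the growing radius `σᵢ(τ) + 5`, agreeing with `Φ ∘ (x ↦ x + drᵢ(tᵢ x))` on the annuli
  whenever the shifted point has flat time `> T + 1`, with pairwise separating truncated
  world-tubes.

This file names them, with **exactly the clauses of the route file, in the same order and with
the same binders**:

* `TangentConeData.Holds 𝓢 S N mo σ dr T U Φ` and `KerrHoleData.Holds 𝓢 S N mo σ dr T U Φ M a τ₀ Ψ`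
  (plain `def … : Prop`, conjunctions; the rest time `tᵢ`, rest-frame distance `dᵢ`, drifted
  tube and near region `Wᵢ` of the route's inner `let`s are the reducible helpers `restTime`,
  `restDist`, `driftedTube`, `KerrHoleData.nearRegion`);
* the unfolding lemmas `TangentConeData.holds_iff` / `KerrHoleData.holds_iff`, whose right-hand
  sides are the route's `let`-lambda bodies **verbatim** and whose proofs are `Iff.rfl`: the
  route's `Cone` (resp. `Holes`) lambda is definitionally equal to `TangentConeData.Holds`
  (resp. `KerrHoleData.Holds`) as a function of its nine (resp. thirteen) arguments, so the four
  items can later be superseded by short restatements with *identical* meaning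
  (`let Cone := TangentConeData.Holds`), never edited in place;
* named projections (`TangentConeData.Holds.isLateChart`, `.basin`, `KerrHoleData.Holds.eq_flatChart`,
  …) so that provers can consume a cone/hole hypothesis clause by clause;
* the bundle `DecoratedTangentCone 𝓢 S` (cone data + hole data + the two proofs as fields), the
  "decorated tangent cone at `i⁺`" of the route's thesis, with `DecoratedTangentCone.nonempty_iff`.

## Sources

The content is the folklore final state picture — "vacuum spacetimes arising from generic
asymptotically flat Cauchy data … will either disperse or settle down to finitely many rotating
Kerr black holes moving away from each other" (Dafermos–Luk, arXiv:1710.01722, p. 8, citing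
Penrose 1982) — organised, following the route's idea card `tangent-cone-at-timelike-infinity`,
after the regularity theory of geometric measure theory (blow-down cone + `ε`-regularity
decoration + cone uniqueness; Allard 1972, Cheeger–Tian 1994 are the *analogy*, not sources of
any clause). The consequence-form measuring devices (`IsLateChart`, `deviationCk`,
`truncDeviationCk`, truncated world-tubes, sublinear excision) are those of
`FinalStateDecomposition` (`KerrConvergence`, design notes), paraphrasing DHRT arXiv:2104.08222 §1
and Klainerman–Szeftel, PAMQ 19 (2023), Thm. 1.1. No printed formulation of either predicate
exists; the docstring tags cite Dafermos–Luk p. 8 for the picture being rendered.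

## Design choices

* **Unbundled predicates first, bundle second.** The route's items quantify the data
  separately (`∃ N mo σ dr T U Φ, Cone …`, `∀ … , Cone … → ∃ M a τ₀ Ψ, Holes …`), so the
  predicates take the data as explicit arguments in the route's order; `DecoratedTangentCone`
  merely bundles them for statements of the form "cone + hole data ⇒ …".
* **Universe-polymorphic** in the spacetime (`Spacetime.{u} 4`); the route instantiates `u = 0`.
* **Constants are the route's conventions** (tube width `5`, annulus `σ + 1 ≤ d < σ + 4`,
  window `|tᵢ − τ| < 1`, margin `|aᵢ| + 6`, flat-time margin `T + 1`, `k = 2`, weight exponent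
  `0`); they are fixed in the statements on purpose (route docstring, "Constants") and are not
  parameters here, so that the defining equations stay definitional.
* **Mathlib.** No Lorentz group, Kerr family or asymptotic-stability notion exists in Mathlib
  (see `KerrConvergence`); only `Set`/`Filter.Tendsto`/`TopologicalSpace.Opens`/
  `Topology.IsOpenEmbedding`/`ContMDiff`/`mfderiv` are used. Nothing here duplicates Mathlib or
  the tree (`lean search 'TangentConeData|KerrHoleData|DecoratedTangentCone'`: no hits).

## What is NOT here

No new mathematics: no claim that any spacetime admits cone or hole data. Instantiating the
cone predicate on Minkowski data (`N = 0`) or on exact sub-extremal Kerr (`N = 1`) is the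
route's own "cheapest falsifier" task (chart calculus on `Opens E4`), deliberately left to it;
the `N = 0` reductions `TangentConeData.holds_zero_iff` / `KerrHoleData.holds_zero_iff` below
only record what the predicates say when there is no ray.

## References

* M. Dafermos, J. Luk, *The interior of dynamical vacuum black holes I*, arXiv:1710.01722,
  p. 8 (final state conjecture, after Penrose 1982, Problem 12).
* M. Dafermos, G. Holzegel, I. Rodnianski, M. Taylor, arXiv:2104.08222, §1 (consequence form
  of convergence to Kerr; see `KerrConvergence`).
* W. K. Allard, *On the first variation of a varifold*, Ann. Math. 95 (1972); J. Cheeger,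
  G. Tian, Invent. Math. 118 (1994) (tangent cones: the organisational analogy only).
-/

noncomputable section

open TopologicalSpace Manifold Filter Topology
open scoped ContDiff Topology ENNReal

universe u

namespace Literature.Geometry.Lorentzian

/-! ### Rest-frame kinematics of a straight world-line `(Λ, c) ∈ O(1,3) × E4` -/

/-- The **rest time** `t_{(Λ,c)}(x) := (Λ⁻¹(x − c))⁰` of the event `x ∈ E4` with respect to the
straight world-line with motion `(Λ, c)` (the time coordinate of `poincareInv Λ c x`; for
`(Λ, c) = (1, 0)` it is `x⁰`). Special-relativistic rest frames: O'Neill 1983, Ch. 9, p. 236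
(as for `poincareInv`). [folklore] -/
def restTime (m : lorentzGroup × E4) (x : E4) : ℝ :=
  poincareInv m.1 m.2 x 0

/-- The **rest-frame Euclidean distance** `d_{(Λ,c)}(x) := |spatial part of Λ⁻¹(x − c)|` of the
event `x` from the straight world-line with motion `(Λ, c)` (`E4.spatialNorm` of
`poincareInv Λ c x`). O'Neill 1983, Ch. 9, p. 236. [folklore] -/
def restDist (m : lorentzGroup × E4) (x : E4) : ℝ :=
  E4.spatialNorm (poincareInv m.1 m.2 x)

/-- Unfolding lemma for `restTime` (O'Neill 1983, Ch. 9). [folklore] -/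
theorem restTime_def (m : lorentzGroup × E4) (x : E4) : restTime m x = poincareInv m.1 m.2 x 0 :=
  rfl

/-- Unfolding lemma for `restDist` (O'Neill 1983, Ch. 9). [folklore] -/
theorem restDist_def (m : lorentzGroup × E4) (x : E4) :
    restDist m x = E4.spatialNorm (poincareInv m.1 m.2 x) :=
  rfl

/-- The rest-frame distance is nonnegative (O'Neill 1983, Ch. 9). [folklore] -/
theorem restDist_nonneg (m : lorentzGroup × E4) (x : E4) : 0 ≤ restDist m x :=
  E4.spatialNorm_nonneg _

/-- The **drifted fat tube** of width `w` after flat time `T` around the world-line with motion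
`m = (Λ, c)`, near-zone radius `σ` and drift `dr` (both functions of rest time):
`tube(w) := (x ↦ x + dr(t_m x)) '' {x | d_m(x) ≤ σ(t_m x) + w} ∩ {y | T < y⁰}` — the set of
rest-frame-near events, translated by the drift at their rest time, cut to the late half-space
(route `TangentConeAtIPlus`, the `let tube` of its items; Dafermos–Luk arXiv:1710.01722, p. 8:
black holes "moving away from each other"). [cite: DafermosLuk2017, p. 8] -/
def driftedTube (m : lorentzGroup × E4) (σ : ℝ → ℝ) (dr : ℝ → E4) (T w : ℝ) : Set E4 :=
  (fun x ↦ x + dr (restTime m x)) '' {x : E4 | restDist m x ≤ σ (restTime m x) + w} ∩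
    {y | T < y 0}

/-- Membership in a drifted tube: `y ∈ tube(w)` iff `y = x + dr(t_m x)` for some `x` with
`d_m(x) ≤ σ(t_m x) + w`, and `T < y⁰` (Dafermos–Luk arXiv:1710.01722, p. 8). [cite: DafermosLuk2017, p. 8] -/
theorem mem_driftedTube_iff {m : lorentzGroup × E4} {σ : ℝ → ℝ} {dr : ℝ → E4} {T w : ℝ}
    {y : E4} :
    y ∈ driftedTube m σ dr T w ↔
      (∃ x : E4, restDist m x ≤ σ (restTime m x) + w ∧ x + dr (restTime m x) = y) ∧ T < y 0 :=
  Iff.rfl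

/-- Drifted tubes grow with the width (Dafermos–Luk arXiv:1710.01722, p. 8). [cite: DafermosLuk2017, p. 8] -/
theorem driftedTube_mono (m : lorentzGroup × E4) (σ : ℝ → ℝ) (dr : ℝ → E4) (T : ℝ) {w w' : ℝ}
    (h : w ≤ w') : driftedTube m σ dr T w ⊆ driftedTube m σ dr T w' := by
  refine Set.inter_subset_inter_left _ (Set.image_mono fun x hx ↦ ?_)
  simp only [Set.mem_setOf_eq] at hx ⊢
  linarith

/-! ### Cone data at `i⁺` -/

namespace TangentConeData

/-- **Cone data at timelike infinity** (the `let Cone` predicate of route `TangentConeAtIPlus`,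
items `FiniteKerrParticleCone` … `DecoratedConeExhausts`, verbatim clause by clause — see
`holds_iff`) for a spacetime `𝓢` relative to `S ⊆ 𝓢.carrier`, with `N` straight world-lines
`mo i = (Λᵢ, cᵢ)`, near-zone radii `σᵢ` and drifts `drᵢ` (functions of rest time), a flat time
`T`, a flat domain `U ⊆ E4` and a flat chart `Φ : U → 𝓢.carrier`:
(1) `(|σᵢ(s)| + ‖drᵢ(s)‖)/s → 0` and `σᵢ → ∞`; (2) the drifted tubes of width `5` are pairwise
disjoint; (3) `U ⊇ {y⁰ > T} ∖ ⋃ᵢ tubeᵢ(0)`; (4) `Φ` is a late chart for the Minkowski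
background on `U` into `J⁺(S)` after `T`; (5) `Φ_* ∂₀` is future-directed on `U`; (6) for
every `δ > 0` the weighted `C²₀` seminorm of `Φ^* g − η` over
`{x⁰ = τ, |x̲| ≤ (1 − δ)τ, dᵢ(x) ≥ δτ ∀ i}` tends to `0` (the tangent cone at `i⁺` is flat off
the rays); (7) the plain `C²` deviation on the slabs `{x⁰ = τ} ∩ U` tends to `0` (wave zone);
(8) BASIN: for each `i` one sub-extremal `(M, a)` such that for all `ε > 0` and `τ₁` there are
`τ ≥ τ₁` and a smooth `Ψ` on the boosted Kerr exterior `(Λᵢ, cᵢ, M, a)`, an open embedding of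
the window `{|tᵢ − τ| < 1, dᵢ < σᵢ(tᵢ) + |a| + 6}`, equal to `Φ(x + drᵢ(tᵢ x))` on the annulus
`σᵢ(tᵢ) + 1 ≤ dᵢ(x) < σᵢ(tᵢ) + 4` of the window (the shifted points lying in `U`), with
`truncDeviationCk … Ψ 2 (σᵢ τ + 5) τ ≤ ε`. Renders the final state picture of Dafermos–Luk
arXiv:1710.01722, p. 8 ("disperse or settle down to finitely many rotating Kerr black holes
moving away from each other") as a blow-down cone with a recurrence clause; no printed
formulation exists. [cite: DafermosLuk2017, p. 8] -/
def Holds (𝓢 : Spacetime.{u} 4) (S : Set 𝓢.carrier) (N : ℕ) (mo : Fin N → lorentzGroup × E4)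
    (σ : Fin N → ℝ → ℝ) (dr : Fin N → ℝ → E4) (T : ℝ) (U : Opens E4) (Φ : U → 𝓢.carrier) :
    Prop :=
  (∀ i, Tendsto (fun s : ℝ ↦ (|σ i s| + ‖dr i s‖) / s) atTop (𝓝 0) ∧
    Tendsto (σ i) atTop atTop) ∧
  (∀ i j, i ≠ j →
    Disjoint (driftedTube (mo i) (σ i) (dr i) T 5) (driftedTube (mo j) (σ j) (dr j) T 5)) ∧
  {y : E4 | T < y 0} \ (⋃ i, driftedTube (mo i) (σ i) (dr i) T 0) ⊆ (U : Set E4) ∧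
  𝓢.IsLateChart (Minkowski.backgroundOn U) (𝓢.metric.causalFuture 𝓢.timeOrientation S) T Φ ∧
  (∀ x : U, 𝓢.timeOrientation.IsFutureDirected
    (mfderiv 𝓘(ℝ, E4) (𝓡 4) Φ x (EuclideanSpace.single 0 1))) ∧
  (∀ δ : ℝ, 0 < δ → Tendsto (fun τ : ℝ ↦ weightedCkSeminorm
    {x : E4 | x 0 = τ ∧ E4.spatialNorm x ≤ (1 - δ) * τ ∧ ∀ i, δ * τ ≤ restDist (mo i) x} 2 0
    (𝓢.deviationExtend (Minkowski.backgroundOn U) Φ)) atTop (𝓝 0)) ∧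
  Tendsto (fun τ : ℝ ↦ 𝓢.deviationCk (Minkowski.backgroundOn U) Φ 2 τ) atTop (𝓝 0) ∧
  (∀ i, ∃ M a : ℝ, Kerr.IsSubextremal M a ∧ ∀ ε : ℝ≥0∞, 0 < ε → ∀ τ₁ : ℝ, ∃ τ : ℝ, τ₁ ≤ τ ∧
    ∃ Ψ : (boostedKerrBackground (mo i).1 (mo i).2 M a).domain → 𝓢.carrier,
      ContMDiff 𝓘(ℝ, E4) (𝓡 4) ∞ Ψ ∧
      IsOpenEmbedding ({x : (boostedKerrBackground (mo i).1 (mo i).2 M a).domain |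
        |restTime (mo i) x.1 - τ| < 1 ∧
          restDist (mo i) x.1 < σ i (restTime (mo i) x.1) + |a| + 6}.restrict Ψ) ∧
      (∀ x : (boostedKerrBackground (mo i).1 (mo i).2 M a).domain,
        |restTime (mo i) x.1 - τ| < 1 → σ i (restTime (mo i) x.1) + 1 ≤ restDist (mo i) x.1 →
          restDist (mo i) x.1 < σ i (restTime (mo i) x.1) + 4 →
          ∃ hx : x.1 + dr i (restTime (mo i) x.1) ∈ (U : Set E4), Ψ x = Φ ⟨_, hx⟩) ∧
      𝓢.truncDeviationCk (boostedKerrBackground (mo i).1 (mo i).2 M a) Ψ 2 (σ i τ + 5) τ ≤ ε)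

variable {𝓢 : Spacetime.{u} 4} {S : Set 𝓢.carrier} {N : ℕ} {mo : Fin N → lorentzGroup × E4}
  {σ : Fin N → ℝ → ℝ} {dr : Fin N → ℝ → E4} {T : ℝ} {U : Opens E4} {Φ : U → 𝓢.carrier}

/-- **Unfolding lemma (verbatim route text).** `TangentConeData.Holds` is, definitionally, the
`let Cone` lambda of route `TangentConeAtIPlus` (rev 0) applied to its nine arguments: the
right-hand side below is that lambda's body character for character (inner `let`s included), and
the proof is `Iff.rfl`. Dafermos–Luk arXiv:1710.01722, p. 8. [cite: DafermosLuk2017, p. 8] -/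
theorem holds_iff (𝓢 : Spacetime.{u} 4) (S : Set 𝓢.carrier) (N : ℕ)
    (mo : Fin N → lorentzGroup × E4) (σ : Fin N → ℝ → ℝ) (dr : Fin N → ℝ → E4) (T : ℝ)
    (U : Opens E4) (Φ : U → 𝓢.carrier) :
    Holds 𝓢 S N mo σ dr T U Φ ↔
      (let t := fun i (x : E4) => poincareInv (mo i).1 (mo i).2 x 0; let d := fun i (x : E4) => E4.spatialNorm (poincareInv (mo i).1 (mo i).2 x); let tube := fun i (w : ℝ) => (fun x ↦ x + dr i (t i x)) '' {x : E4 | d i x ≤ σ i (t i x) + w} ∩ {y | T < y 0}; let F := Minkowski.backgroundOn U; (∀ i, Tendsto (fun s : ℝ ↦ (|σ i s| + ‖dr i s‖) / s) atTop (𝓝 0) ∧ Tendsto (σ i) atTop atTop) ∧ (∀ i j, i ≠ j → Disjoint (tube i 5) (tube j 5)) ∧ {y : E4 | T < y 0} \ (⋃ i, tube i 0) ⊆ (U : Set E4) ∧ 𝓢.IsLateChart F (𝓢.metric.causalFuture 𝓢.timeOrientation S) T Φ ∧ (∀ x : U, 𝓢.timeOrientation.IsFutureDirected (mfderiv 𝓘(ℝ,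 E4) (𝓡 4) Φ x (EuclideanSpace.single 0 1))) ∧ (∀ δ : ℝ, 0 < δ → Tendsto (fun τ : ℝ ↦ weightedCkSeminorm {x : E4 | x 0 = τ ∧ E4.spatialNorm x ≤ (1 - δ) * τ ∧ ∀ i, δ * τ ≤ d i x} 2 0 (𝓢.deviationExtend F Φ)) atTop (𝓝 0)) ∧ Tendsto (fun τ : ℝ ↦ 𝓢.deviationCk F Φ 2 τ) atTop (𝓝 0) ∧ (∀ i, ∃ M a : ℝ, Kerr.IsSubextremal M a ∧ ∀ ε : ENNReal, 0 < ε → ∀ τ₁ : ℝ, ∃ τ : ℝ, τ₁ ≤ τ ∧ (let B := boostedKerrBackground (mo i).1 (mo i).2 M a; ∃ Ψ : B.domain → 𝓢.carrier, ContMDiff 𝓘(ℝ, E4) (𝓡 4) ∞ Ψ ∧ Topology.IsOpenEmbedding ({x : B.domain | |t i x.1 - τ| < 1 ∧ d i x.1 < σ i (t i x.1) + |a| + 6}.restrict Ψ) ∧ (∀ x : B.domain, |t i x.1 - τ| < 1 → σ i (t i x.1) + 1 ≤ d i x.1 → d i x.1 < σ i (t i x.1) + 4 → ∃ hx : x.1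 + dr i (t i x.1) ∈ (U : Set E4), Ψ x = Φ ⟨_, hx⟩) ∧ 𝓢.truncDeviationCk B Ψ 2 (σ i τ + 5) τ ≤ ε))) :=
  Iff.rfl

namespace Holds

variable (h : Holds 𝓢 S N mo σ dr T U Φ)
include h

/-- Clause (1a): near-zone radius and drift are jointly sublinear in rest time,
`(|σᵢ(s)| + ‖drᵢ(s)‖)/s → 0` (Dafermos–Luk arXiv:1710.01722, p. 8). [cite: DafermosLuk2017, p. 8] -/
theorem tendsto_div (i : Fin N) :
    Tendsto (fun s : ℝ ↦ (|σ i s| + ‖dr i s‖) / s) atTop (𝓝 0) :=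
  (h.1 i).1

/-- Clause (1b): the near-zone radii tend to infinity, `σᵢ → ∞`
(Dafermos–Luk arXiv:1710.01722, p. 8). [cite: DafermosLuk2017, p. 8] -/
theorem tendsto_atTop (i : Fin N) : Tendsto (σ i) atTop atTop :=
  (h.1 i).2

/-- Clause (2): the drifted fat tubes of width `5` are pairwise disjoint
(Dafermos–Luk arXiv:1710.01722, p. 8: "moving away from each other"). [cite: DafermosLuk2017, p. 8] -/
theorem disjoint_driftedTube {i j : Fin N} (hij : i ≠ j) :
    Disjoint (driftedTube (mo i) (σ i) (dr i) T 5) (driftedTube (mo j) (σ j) (dr j) T 5) :=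
  h.2.1 i j hij

/-- Clause (3): the flat domain contains the late half-space minus the thin drifted tubes,
`{y⁰ > T} ∖ ⋃ᵢ tubeᵢ(0) ⊆ U` (Dafermos–Luk arXiv:1710.01722, p. 8). [cite: DafermosLuk2017, p. 8] -/
theorem diff_subset : {y : E4 | T < y 0} \ (⋃ i, driftedTube (mo i) (σ i) (dr i) T 0) ⊆ (U : Set E4) :=
  h.2.2.1

/-- Clause (4): the flat chart is a late-time chart for the Minkowski background on `U` into
`J⁺(S)` after time `T` (DHRT arXiv:2104.08222, §1, consequence form; Dafermos–Luk
arXiv:1710.01722, p. 8). [cite: DafermosLuk2017, p. 8] -/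
theorem isLateChart :
    𝓢.IsLateChart (Minkowski.backgroundOn U) (𝓢.metric.causalFuture 𝓢.timeOrientation S) T Φ :=
  h.2.2.2.1

/-- Clause (5): `Φ_* ∂₀` is future-directed everywhere on `U` (Dafermos–Luk arXiv:1710.01722,
p. 8). [cite: DafermosLuk2017, p. 8] -/
theorem isFutureDirected (x : U) :
    𝓢.timeOrientation.IsFutureDirected (mfderiv 𝓘(ℝ, E4) (𝓡 4) Φ x (EuclideanSpace.single 0 1)) :=
  h.2.2.2.2.1 x

/-- Clause (6): scale-invariant weighted `C²`-flatness in the timelike interior off the rays —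
for every `δ > 0` the weighted `C²₀` seminorm of `Φ^* g − η` over
`{x⁰ = τ, |x̲| ≤ (1 − δ)τ, dᵢ(x) ≥ δτ ∀ i}` tends to `0` (Dafermos–Luk arXiv:1710.01722, p. 8:
"disperse"). [cite: DafermosLuk2017, p. 8] -/
theorem tendsto_weightedCkSeminorm {δ : ℝ} (hδ : 0 < δ) :
    Tendsto (fun τ : ℝ ↦ weightedCkSeminorm
      {x : E4 | x 0 = τ ∧ E4.spatialNorm x ≤ (1 - δ) * τ ∧ ∀ i, δ * τ ≤ restDist (mo i) x} 2 0
      (𝓢.deviationExtend (Minkowski.backgroundOn U) Φ)) atTop (𝓝 0) :=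
  h.2.2.2.2.2.1 δ hδ

/-- Clause (7): plain `C²`-flatness on the whole flat slabs `{x⁰ = τ} ∩ U` (wave zone;
Dafermos–Luk arXiv:1710.01722, p. 8). [cite: DafermosLuk2017, p. 8] -/
theorem tendsto_deviationCk :
    Tendsto (fun τ : ℝ ↦ 𝓢.deviationCk (Minkowski.backgroundOn U) Φ 2 τ) atTop (𝓝 0) :=
  h.2.2.2.2.2.2.1

/-- Clause (8), BASIN: for each ray one fixed sub-extremal `(M, a)` such that for every `ε > 0`
the ray is, at arbitrarily late rest times, `ε`-close in `C²` to boosted Kerr `(Λᵢ, cᵢ, M, a)`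
on the truncated slab `{t*ᵢ = τ, rᵢ ≤ σᵢ(τ) + 5}` in a chart glued to `Φ ∘ shift` on the annulus
(Dafermos–Luk arXiv:1710.01722, p. 8: "settle down to … Kerr black holes"). [cite: DafermosLuk2017, p. 8] -/
theorem basin (i : Fin N) :
    ∃ M a : ℝ, Kerr.IsSubextremal M a ∧ ∀ ε : ℝ≥0∞, 0 < ε → ∀ τ₁ : ℝ, ∃ τ : ℝ, τ₁ ≤ τ ∧
      ∃ Ψ : (boostedKerrBackground (mo i).1 (mo i).2 M a).domain → 𝓢.carrier,
        ContMDiff 𝓘(ℝ, E4) (𝓡 4) ∞ Ψ ∧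
        IsOpenEmbedding ({x : (boostedKerrBackground (mo i).1 (mo i).2 M a).domain |
          |restTime (mo i) x.1 - τ| < 1 ∧
            restDist (mo i) x.1 < σ i (restTime (mo i) x.1) + |a| + 6}.restrict Ψ) ∧
        (∀ x : (boostedKerrBackground (mo i).1 (mo i).2 M a).domain,
          |restTime (mo i) x.1 - τ| < 1 → σ i (restTime (mo i) x.1) + 1 ≤ restDist (mo i) x.1 →
            restDist (mo i) x.1 < σ i (restTime (mo i) x.1) + 4 →
            ∃ hx : x.1 + dr i (restTime (mo i) x.1) ∈ (U : Set E4), Ψ x = Φ ⟨_, hx⟩) ∧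
        𝓢.truncDeviationCk (boostedKerrBackground (mo i).1 (mo i).2 M a) Ψ 2 (σ i τ + 5) τ ≤
          ε :=
  h.2.2.2.2.2.2.2 i

/-- From clauses (3) and (4): the part of the late half-space off the thin tubes is charted into
`J⁺(S)` — `Φ '' ({y⁰ > T} ∖ ⋃ᵢ tubeᵢ(0)) ⊆ J⁺(S)` (Dafermos–Luk arXiv:1710.01722, p. 8). [cite: DafermosLuk2017, p. 8] -/
theorem image_subset_causalFuture :
    (fun x : U ↦ Φ x) '' {x : U | T < x.1 0} ⊆ 𝓢.metric.causalFuture 𝓢.timeOrientation S :=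
  h.isLateChart.image_subset

end Holds

/-- Anti-vacuity bookkeeping (`N = 0`, no ray): cone data without rays say exactly that `U`
contains the whole late half-space `{y⁰ > T}`, `Φ` is a future-oriented late chart into `J⁺(S)`,
`Φ^* g − η → 0` in the scale-invariant weighted `C²` norm on every timelike cone
`{x⁰ = τ, |x̲| ≤ (1 − δ)τ}` and in plain `C²` on the slabs — the consequence form of
"the solution disperses" (Dafermos–Luk arXiv:1710.01722, p. 8; Christodoulou–Klainerman 1993,
Thm. 1.0.2). [cite: DafermosLuk2017, p. 8] -/
theorem holds_zero_iff (𝓢 : Spacetime.{u} 4) (S : Set 𝓢.carrier)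
    (mo : Fin 0 → lorentzGroup × E4) (σ : Fin 0 → ℝ → ℝ) (dr : Fin 0 → ℝ → E4) (T : ℝ)
    (U : Opens E4) (Φ : U → 𝓢.carrier) :
    Holds 𝓢 S 0 mo σ dr T U Φ ↔
      {y : E4 | T < y 0} ⊆ (U : Set E4) ∧
      𝓢.IsLateChart (Minkowski.backgroundOn U) (𝓢.metric.causalFuture 𝓢.timeOrientation S) T Φ ∧
      (∀ x : U, 𝓢.timeOrientation.IsFutureDirected
        (mfderiv 𝓘(ℝ, E4) (𝓡 4) Φ x (EuclideanSpace.single 0 1))) ∧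
      (∀ δ : ℝ, 0 < δ → Tendsto (fun τ : ℝ ↦ weightedCkSeminorm
        {x : E4 | x 0 = τ ∧ E4.spatialNorm x ≤ (1 - δ) * τ} 2 0
        (𝓢.deviationExtend (Minkowski.backgroundOn U) Φ)) atTop (𝓝 0)) ∧
      Tendsto (fun τ : ℝ ↦ 𝓢.deviationCk (Minkowski.backgroundOn U) Φ 2 τ) atTop (𝓝 0) := by
  simp only [Holds, IsEmpty.forall_iff, true_and, and_true, Set.iUnion_of_empty, Set.sdiff_empty]

end TangentConeData

/-! ### Kerr hole data decorating the rays -/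

namespace KerrHoleData

/-- The **near region** `W := {x | τ₀ < t_m(x), d_m(x) < σ(t_m x) + |a| + 6}` of the boosted
Kerr exterior with motion `m = (Λ, c)` and parameters `(M, a)`: the late rest-frame
neighbourhood of the world-line out to the near-zone radius plus the margin `|a| + 6` (route
`TangentConeAtIPlus`, the `let W` of `KerrCaptureOnRays`; Dafermos–Luk arXiv:1710.01722, p. 8). [cite: DafermosLuk2017, p. 8] -/
def nearRegion (m : lorentzGroup × E4) (M a : ℝ) (σ : ℝ → ℝ) (τ₀ : ℝ) :
    Set (boostedKerrBackground m.1 m.2 M a).domain :=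
  {x | τ₀ < restTime m x.1 ∧ restDist m x.1 < σ (restTime m x.1) + |a| + 6}

/-- Membership in the near region (Dafermos–Luk arXiv:1710.01722, p. 8). [cite: DafermosLuk2017, p. 8] -/
@[simp]
theorem mem_nearRegion {m : lorentzGroup × E4} {M a : ℝ} {σ : ℝ → ℝ} {τ₀ : ℝ}
    {x : (boostedKerrBackground m.1 m.2 M a).domain} :
    x ∈ nearRegion m M a σ τ₀ ↔ τ₀ < restTime m x.1 ∧ restDist m x.1 < σ (restTime m x.1) + |a| + 6 :=
  Iff.rfl

/-- The near region lies in the late region `{t* > τ₀}` of the boosted Kerr background (its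
time function is the rest time). DHRT arXiv:2104.08222, §1; Dafermos–Luk arXiv:1710.01722,
p. 8. [cite: DafermosLuk2017, p. 8] -/
theorem nearRegion_subset_lateRegion (m : lorentzGroup × E4) (M a : ℝ) (σ : ℝ → ℝ) (τ₀ : ℝ) :
    nearRegion m M a σ τ₀ ⊆ (boostedKerrBackground m.1 m.2 M a).lateRegion τ₀ :=
  fun _ hx ↦ hx.1

/-- **Kerr hole data** (the `let Holes` predicate of route `TangentConeAtIPlus`, items
`KerrCaptureOnRays` and `DecoratedConeExhausts`, verbatim clause by clause — see `holds_iff`)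
decorating cone data `(N, mo, σ, dr, T, U, Φ)` of `𝓢` relative to `S`: parameters
`(Mᵢ, aᵢ)`, a rest time `τ₀` and charts `Ψᵢ` of the boosted Kerr exteriors
`(Λᵢ, cᵢ, Mᵢ, aᵢ)` such that (1) every `(Mᵢ, aᵢ)` is sub-extremal; (2) `T ≤ τ₀`; (3) each `Ψᵢ`
is smooth, an open embedding of the near region `Wᵢ = {tᵢ > τ₀, dᵢ < σᵢ(tᵢ) + |aᵢ| + 6}`, with
`Ψᵢ(Wᵢ) ⊆ J⁺(S)`; (4) the `C²` deviation from boosted Kerr tends to `0` on every truncated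
slab `{t*ᵢ = τ, rᵢ ≤ r}`; (5) and on `{t*ᵢ = τ, rᵢ ≤ σᵢ(τ) + 5}`; (6) on the annulus
`σᵢ(tᵢ) + 1 ≤ dᵢ < σᵢ(tᵢ) + 4` of `Wᵢ`, wherever the shifted point `x + drᵢ(tᵢ x)` has flat
time `> T + 1`, it lies in `U` and `Ψᵢ x = Φ(x + drᵢ(tᵢ x))`; (7) for every `r` the truncated
world-tubes `Ψᵢ({t*ᵢ > τ₁, rᵢ ≤ r})` are pairwise disjoint for some `τ₁`. Kerr stability in
consequence form used as `ε`-regularity along each ray (DHRT arXiv:2104.08222 §1;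
Klainerman–Szeftel, PAMQ 19 (2023), Thm. 1.1), rendering Dafermos–Luk arXiv:1710.01722, p. 8;
no printed formulation exists. [cite: DafermosLuk2017, p. 8] -/
def Holds (𝓢 : Spacetime.{u} 4) (S : Set 𝓢.carrier) (N : ℕ) (mo : Fin N → lorentzGroup × E4)
    (σ : Fin N → ℝ → ℝ) (dr : Fin N → ℝ → E4) (T : ℝ) (U : Opens E4) (Φ : U → 𝓢.carrier)
    (M a : Fin N → ℝ) (τ₀ : ℝ)
    (Ψ : ∀ i, (boostedKerrBackground (mo i).1 (mo i).2 (M i) (a i)).domain → 𝓢.carrier) :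
    Prop :=
  (∀ i, Kerr.IsSubextremal (M i) (a i)) ∧
  T ≤ τ₀ ∧
  (∀ i, ContMDiff 𝓘(ℝ, E4) (𝓡 4) ∞ (Ψ i) ∧
    IsOpenEmbedding ((nearRegion (mo i) (M i) (a i) (σ i) τ₀).restrict (Ψ i)) ∧
    Ψ i '' nearRegion (mo i) (M i) (a i) (σ i) τ₀ ⊆
      𝓢.metric.causalFuture 𝓢.timeOrientation S) ∧
  (∀ i (r : ℝ), Tendsto (fun τ : ℝ ↦
    𝓢.truncDeviationCk (boostedKerrBackground (mo i).1 (mo i).2 (M i) (a i)) (Ψ i) 2 r τ)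
    atTop (𝓝 0)) ∧
  (∀ i, Tendsto (fun τ : ℝ ↦ 𝓢.truncDeviationCk
    (boostedKerrBackground (mo i).1 (mo i).2 (M i) (a i)) (Ψ i) 2 (σ i τ + 5) τ) atTop (𝓝 0)) ∧
  (∀ i (x : (boostedKerrBackground (mo i).1 (mo i).2 (M i) (a i)).domain),
    τ₀ < restTime (mo i) x.1 → σ i (restTime (mo i) x.1) + 1 ≤ restDist (mo i) x.1 →
      restDist (mo i) x.1 < σ i (restTime (mo i) x.1) + 4 →
      T + 1 < (x.1 + dr i (restTime (mo i) x.1)) 0 →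
      ∃ hx : x.1 + dr i (restTime (mo i) x.1) ∈ (U : Set E4), Ψ i x = Φ ⟨_, hx⟩) ∧
  (∀ r : ℝ, ∃ τ₁ : ℝ, Pairwise (Function.onFun Disjoint fun i ↦
    Ψ i '' (boostedKerrBackground (mo i).1 (mo i).2 (M i) (a i)).truncLateRegion τ₁ r))

variable {𝓢 : Spacetime.{u} 4} {S : Set 𝓢.carrier} {N : ℕ} {mo : Fin N → lorentzGroup × E4}
  {σ : Fin N → ℝ → ℝ} {dr : Fin N → ℝ → E4} {T : ℝ} {U : Opens E4} {Φ : U → 𝓢.carrier}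
  {M a : Fin N → ℝ} {τ₀ : ℝ}
  {Ψ : ∀ i, (boostedKerrBackground (mo i).1 (mo i).2 (M i) (a i)).domain → 𝓢.carrier}

/-- **Unfolding lemma (verbatim route text).** `KerrHoleData.Holds` is, definitionally, the
`let Holes` lambda of route `TangentConeAtIPlus` (rev 0) applied to its thirteen arguments: the
right-hand side below is that lambda's body character for character (its `let B`, then — the
binder `fun Ψ ↦` being already applied — its `let t`, `let d`, `let W` and the conjunction), and
the proof is `Iff.rfl`. Dafermos–Luk arXiv:1710.01722, p. 8. [cite: DafermosLuk2017, p. 8] -/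
theorem holds_iff (𝓢 : Spacetime.{u} 4) (S : Set 𝓢.carrier) (N : ℕ)
    (mo : Fin N → lorentzGroup × E4) (σ : Fin N → ℝ → ℝ) (dr : Fin N → ℝ → E4) (T : ℝ)
    (U : Opens E4) (Φ : U → 𝓢.carrier) (M a : Fin N → ℝ) (τ₀ : ℝ)
    (Ψ : ∀ i, (boostedKerrBackground (mo i).1 (mo i).2 (M i) (a i)).domain → 𝓢.carrier) :
    Holds 𝓢 S N mo σ dr T U Φ M a τ₀ Ψ ↔
      (let B := fun i => boostedKerrBackground (mo i).1 (mo i).2 (M i) (a i); let t := fun i (x : E4) => poincareInv (mo i).1 (mo i).2 x 0; let d := fun i (x : E4) => E4.spatialNorm (poincareInv (mo i).1 (mo i).2 x); let W := fun i => {x : (B i).domain | τ₀ < t i x.1 ∧ d i x.1 < σ i (t i x.1) + |a i| + 6}; (∀ i, Kerr.IsSubextremal (M i) (a i)) ∧ T ≤ τ₀ ∧ (∀ i, ContMDiff 𝓘(ℝ, E4) (𝓡 4) ∞ (Ψ i) ∧ Topology.IsOpenEmbedding ((W i).restrict (Ψ i)) ∧ Ψ i '' W i ⊆ 𝓢.metric.causalFuture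 𝓢.timeOrientation S) ∧ (∀ i (r : ℝ), Tendsto (fun τ : ℝ ↦ 𝓢.truncDeviationCk (B i) (Ψ i) 2 r τ) atTop (𝓝 0)) ∧ (∀ i, Tendsto (fun τ : ℝ ↦ 𝓢.truncDeviationCk (B i) (Ψ i) 2 (σ i τ + 5) τ) atTop (𝓝 0)) ∧ (∀ i (x : (B i).domain), τ₀ < t i x.1 → σ i (t i x.1) + 1 ≤ d i x.1 → d i x.1 < σ i (t i x.1) + 4 → T + 1 < (x.1 + dr i (t i x.1)) 0 → ∃ hx : x.1 + dr i (t i x.1) ∈ (U : Set E4), Ψ i x = Φ ⟨_, hx⟩) ∧ (∀ r : ℝ, ∃ τ₁ : ℝ, Pairwise (Function.onFun Disjoint fun i ↦ Ψ i '' (B i).truncLateRegion τ₁ r))) :=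
  Iff.rfl

namespace Holds

variable (h : Holds 𝓢 S N mo σ dr T U Φ M a τ₀ Ψ)
include h

/-- Clause (1): every hole is sub-extremal, `|aᵢ| < Mᵢ` (Dafermos–Luk arXiv:1710.01722, p. 8,
with the strictness of the summit statement). [cite: DafermosLuk2017, p. 8] -/
theorem isSubextremal (i : Fin N) : Kerr.IsSubextremal (M i) (a i) :=
  h.1 i

/-- Clause (2): the hole charts start no earlier than the cone's flat time, `T ≤ τ₀`
(Dafermos–Luk arXiv:1710.01722, p. 8). [cite: DafermosLuk2017, p. 8] -/
theorem le_τ₀ : T ≤ τ₀ :=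
  h.2.1

/-- Clause (3a): each hole chart is smooth on the whole boosted Kerr exterior
(DHRT arXiv:2104.08222, §1; Dafermos–Luk arXiv:1710.01722, p. 8). [cite: DafermosLuk2017, p. 8] -/
theorem contMDiff (i : Fin N) : ContMDiff 𝓘(ℝ, E4) (𝓡 4) ∞ (Ψ i) :=
  (h.2.2.1 i).1

/-- Clause (3b): each hole chart restricted to its near region `Wᵢ` is an open embedding
(DHRT arXiv:2104.08222, §1; Dafermos–Luk arXiv:1710.01722, p. 8). [cite: DafermosLuk2017, p. 8] -/
theorem isOpenEmbedding (i : Fin N) :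
    IsOpenEmbedding ((nearRegion (mo i) (M i) (a i) (σ i) τ₀).restrict (Ψ i)) :=
  (h.2.2.1 i).2.1

/-- Clause (3c): the near regions are charted into `J⁺(S)` (Dafermos–Luk arXiv:1710.01722,
p. 8). [cite: DafermosLuk2017, p. 8] -/
theorem image_nearRegion_subset (i : Fin N) :
    Ψ i '' nearRegion (mo i) (M i) (a i) (σ i) τ₀ ⊆ 𝓢.metric.causalFuture 𝓢.timeOrientation S :=
  (h.2.2.1 i).2.2

/-- Clause (4): `C²` convergence to boosted Kerr on every truncated slab of fixed radius `r`
(DHRT arXiv:2104.08222, §1; Dafermos–Luk arXiv:1710.01722, p. 8). [cite: DafermosLuk2017, p. 8] -/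
theorem tendsto_truncDeviationCk (i : Fin N) (r : ℝ) :
    Tendsto (fun τ : ℝ ↦
      𝓢.truncDeviationCk (boostedKerrBackground (mo i).1 (mo i).2 (M i) (a i)) (Ψ i) 2 r τ)
      atTop (𝓝 0) :=
  h.2.2.2.1 i r

/-- Clause (5): `C²` convergence to boosted Kerr out to the growing radius `σᵢ(τ) + 5`
(Dafermos–Luk arXiv:1710.01722, p. 8). [cite: DafermosLuk2017, p. 8] -/
theorem tendsto_truncDeviationCk_growing (i : Fin N) :
    Tendsto (fun τ : ℝ ↦ 𝓢.truncDeviationCk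
      (boostedKerrBackground (mo i).1 (mo i).2 (M i) (a i)) (Ψ i) 2 (σ i τ + 5) τ) atTop (𝓝 0) :=
  h.2.2.2.2.1 i

/-- Clause (6): agreement with the drifted flat chart on the annulus — for `x` in the near
region's annulus `σᵢ(tᵢ) + 1 ≤ dᵢ(x) < σᵢ(tᵢ) + 4` whose shifted point has flat time `> T + 1`,
the shifted point lies in `U` and `Ψᵢ x = Φ(x + drᵢ(tᵢ x))` (Dafermos–Luk arXiv:1710.01722,
p. 8). [cite: DafermosLuk2017, p. 8] -/
theorem eq_flatChart (i : Fin N) (x : (boostedKerrBackground (mo i).1 (mo i).2 (M i) (a i)).domain)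
    (ht : τ₀ < restTime (mo i) x.1) (h₁ : σ i (restTime (mo i) x.1) + 1 ≤ restDist (mo i) x.1)
    (h₄ : restDist (mo i) x.1 < σ i (restTime (mo i) x.1) + 4)
    (hT : T + 1 < (x.1 + dr i (restTime (mo i) x.1)) 0) :
    ∃ hx : x.1 + dr i (restTime (mo i) x.1) ∈ (U : Set E4), Ψ i x = Φ ⟨_, hx⟩ :=
  h.2.2.2.2.2.1 i x ht h₁ h₄ hT

/-- Clause (7): the holes separate — for every `r` the truncated world-tubes
`Ψᵢ({t*ᵢ > τ₁, rᵢ ≤ r})` are pairwise disjoint for some `τ₁` (Dafermos–Luk arXiv:1710.01722,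
p. 8: "moving away from each other"). [cite: DafermosLuk2017, p. 8] -/
theorem exists_pairwise_disjoint (r : ℝ) :
    ∃ τ₁ : ℝ, Pairwise (Function.onFun Disjoint fun i ↦
      Ψ i '' (boostedKerrBackground (mo i).1 (mo i).2 (M i) (a i)).truncLateRegion τ₁ r) :=
  h.2.2.2.2.2.2 r

end Holds

/-- Anti-vacuity bookkeeping (`N = 0`, no hole): hole data without holes say exactly `T ≤ τ₀`
(all other clauses quantify over `Fin 0`). Dafermos–Luk arXiv:1710.01722, p. 8 ("disperse"). [cite: DafermosLuk2017, p. 8] -/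
theorem holds_zero_iff (𝓢 : Spacetime.{u} 4) (S : Set 𝓢.carrier)
    (mo : Fin 0 → lorentzGroup × E4) (σ : Fin 0 → ℝ → ℝ) (dr : Fin 0 → ℝ → E4) (T : ℝ)
    (U : Opens E4) (Φ : U → 𝓢.carrier) (M a : Fin 0 → ℝ) (τ₀ : ℝ)
    (Ψ : ∀ i, (boostedKerrBackground (mo i).1 (mo i).2 (M i) (a i)).domain → 𝓢.carrier) :
    Holds 𝓢 S 0 mo σ dr T U Φ M a τ₀ Ψ ↔ T ≤ τ₀ :=
  ⟨fun h ↦ h.2.1, fun h ↦ ⟨fun i ↦ i.elim0, h, fun i ↦ i.elim0, fun i ↦ i.elim0, fun i ↦ i.elim0,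
    fun i ↦ i.elim0, fun _ ↦ ⟨0, fun i ↦ i.elim0⟩⟩⟩

end KerrHoleData

/-! ### The decorated tangent cone -/

/-- **Hypothesis structure: a decorated tangent cone at `i⁺`** of the spacetime `𝓢` relative to
`S ⊆ 𝓢.carrier` (route `TangentConeAtIPlus`: "blow down first — the final state as a decorated
tangent cone at `i⁺`"): cone data — `N` rays with motions `(Λᵢ, cᵢ)`, near-zone radii, drifts,
a flat time, a flat domain and a flat chart satisfying `TangentConeData.Holds` — decorated by
Kerr hole data — masses, spins, a late rest time and hole charts satisfying
`KerrHoleData.Holds`. The `N`-black-hole final state picture of Dafermos–Luk arXiv:1710.01722,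
p. 8 (after Penrose 1982, Problem 12) in the blow-down/blow-up organisation of the route; compare
the audited interface `FinalStateDecomposition` (`KerrConvergence`), into which the route's item
`DecoratedConeExhausts` converts it. No printed formulation exists. [cite: DafermosLuk2017, p. 8] -/
structure DecoratedTangentCone (𝓢 : Spacetime.{u} 4) (S : Set 𝓢.carrier) where
  /-- The number of rays (final black holes). -/
  N : ℕ
  /-- The motion `(Λᵢ, cᵢ) ∈ O(1,3) × E4` of ray `i` (a straight world-line). -/
  motion : Fin N → lorentzGroup × E4
  /-- The near-zone radius `σᵢ` of ray `i`, as a function of rest time. -/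
  nearRadius : Fin N → ℝ → ℝ
  /-- The drift `drᵢ` of ray `i`, as a function of rest time. -/
  drift : Fin N → ℝ → E4
  /-- The flat time `T` after which the cone data hold. -/
  T : ℝ
  /-- The coordinate domain `U ⊆ E4` of the flat chart. -/
  flatDomain : Opens E4
  /-- The flat (blow-down) chart. -/
  flatChart : flatDomain → 𝓢.carrier
  /-- The mass `Mᵢ` of hole `i`. -/
  mass : Fin N → ℝ
  /-- The specific angular momentum `aᵢ` of hole `i`. -/
  spin : Fin N → ℝ
  /-- The common initial rest time `τ₀` of the hole charts. -/
  τ₀ : ℝ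
  /-- The chart of hole `i`, on the boosted Kerr exterior `(Λᵢ, cᵢ, Mᵢ, aᵢ)`. -/
  holeChart : ∀ i, (boostedKerrBackground (motion i).1 (motion i).2 (mass i) (spin i)).domain →
    𝓢.carrier
  /-- The cone data hold. -/
  cone : TangentConeData.Holds 𝓢 S N motion nearRadius drift T flatDomain flatChart
  /-- The hole data hold. -/
  holes : KerrHoleData.Holds 𝓢 S N motion nearRadius drift T flatDomain flatChart mass spin τ₀
    holeChart

namespace DecoratedTangentCone

variable {𝓢 : Spacetime.{u} 4} {S : Set 𝓢.carrier}

/-- The reference background of hole `i` of a decorated tangent cone (boosted Kerr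
`(Mᵢ, aᵢ)` with motion `(Λᵢ, cᵢ)`); Dafermos–Luk arXiv:1710.01722, p. 8. [cite: DafermosLuk2017, p. 8] -/
def background (c : DecoratedTangentCone 𝓢 S) (i : Fin c.N) : ModelBackground :=
  boostedKerrBackground (c.motion i).1 (c.motion i).2 (c.mass i) (c.spin i)

/-- Every hole of a decorated tangent cone is sub-extremal (Dafermos–Luk arXiv:1710.01722,
p. 8). [cite: DafermosLuk2017, p. 8] -/
theorem isSubextremal (c : DecoratedTangentCone 𝓢 S) (i : Fin c.N) :
    Kerr.IsSubextremal (c.mass i) (c.spin i) :=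
  c.holes.isSubextremal i

/-- The hole charts start no earlier than the flat time, `T ≤ τ₀` (Dafermos–Luk
arXiv:1710.01722, p. 8). [cite: DafermosLuk2017, p. 8] -/
theorem T_le_τ₀ (c : DecoratedTangentCone 𝓢 S) : c.T ≤ c.τ₀ :=
  c.holes.le_τ₀

/-- A decorated tangent cone exists iff some cone data admit some hole data — the shape in
which the route's items quantify (`∃ … , Cone …` / `Cone … → ∃ … , Holes …`). Dafermos–Luk
arXiv:1710.01722, p. 8. [cite: DafermosLuk2017, p. 8] -/
theorem nonempty_iff :
    Nonempty (DecoratedTangentCone 𝓢 S) ↔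
      ∃ (N : ℕ) (mo : Fin N → lorentzGroup × E4) (σ : Fin N → ℝ → ℝ) (dr : Fin N → ℝ → E4)
        (T : ℝ) (U : Opens E4) (Φ : U → 𝓢.carrier),
        TangentConeData.Holds 𝓢 S N mo σ dr T U Φ ∧
          ∃ (M a : Fin N → ℝ) (τ₀ : ℝ)
            (Ψ : ∀ i, (boostedKerrBackground (mo i).1 (mo i).2 (M i) (a i)).domain → 𝓢.carrier),
            KerrHoleData.Holds 𝓢 S N mo σ dr T U Φ M a τ₀ Ψ :=
  ⟨fun ⟨c⟩ ↦ ⟨c.N, c.motion, c.nearRadius, c.drift, c.T, c.flatDomain, c.flatChart, c.cone,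
      c.mass, c.spin, c.τ₀, c.holeChart, c.holes⟩,
    fun ⟨N, mo, σ, dr, T, U, Φ, hc, M, a, τ₀, Ψ, hh⟩ ↦
      ⟨⟨N, mo, σ, dr, T, U, Φ, M, a, τ₀, Ψ, hc, hh⟩⟩⟩

end DecoratedTangentCone

end Literature.Geometry.Lorentzian

end
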